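import Literature.Analysis.FluidPDE.JetPerturbation
import Literature.Analysis.FluidPDE.CLStressAlgebra
import HarnessLib

/-!
# The intermittent-jet perturbation: the stress algebra (BV §7.6, identity `(⋆)`)

Analysis/FluidPDE support file (everything proved) for the Reynolds-stress step of the
intermittent convex-integration scheme of Buckmaster–Vicol (EMS Surv. Math. Sci. 6 (2019), §7.6
(7.47)–(7.59)), for the perturbation `D.w` of `JetPerturbation`. Pointwise identities:

* `∂ₜ(η²ψ̃²) = μ' (k·∇)(η²ψ̃²)` (BV (7.20) squared), `w^{(p)} ⊗ w^{(p)} = ∑_x F_x k_x ⊗ k_x`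
  (disjoint supports, BV (7.18), (7.34)), `div (w^{(p)} ⊗ w^{(p)}) = ∑_x ((k_x·∇)F_x) k_x`;
* `M = ρ Id - ∑_x a_x² k_x ⊗ k_x` and `div M = ∇ρ - ∑_x ((k_x·∇)a_x²) k_x` (BV (7.30));
* the time derivatives of `F_x`, `X`, `ζ`, `w`;
* the oscillation expansion `((k·∇)a²)(η²ψ̃² - 1) k = div S_osc - ∇π_osc - r_osc` with
  `η²ψ̃² - 1 = ΔΨ`, `Ψ = Δ⁻¹(η²ψ̃² - 1)` (BV (7.55)–(7.56) with `OscillatoryExpansion`);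
* **the identity `(⋆)`**: `∂ₜw + div(w ⊗ w) + div(R_c + M̊) = div S₁ + ∇q + f` with explicit
  `S₁` (carried stress + cross terms + oscillation tensors), `q`, and `f` (the part still to be
  inverted by `ℛ`: `∂ₜ(w^{(p)}+w^{(c)})`, the oscillation remainders, the `(μ')⁻¹ ∂ₜa²` term and a
  function of time), the input of `Torus.IsNSReynoldsOn.perturb_visc`.

## References

* T. Buckmaster, V. Vicol, EMS Surv. Math. Sci. 6 (2019) = arXiv:1901.09023, §7.5.3 (7.37)–(7.39),
  §7.6 (7.47)–(7.59). [`BuckmasterVicol2020`]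
-/

noncomputable section

open MeasureTheory Set Filter Topology Function
open scoped InnerProductSpace ContDiff ENNReal

namespace Literature.Analysis.FluidPDE

namespace JetStep

open Literature.Analysis.FunctionSpaces FunctionSpaces.Torus Mikado NashGeometric Jet

local notation "𝕋³" => UnitAddTorus (Fin 3)
local notation "E³" => EuclideanSpace ℝ (Fin 3)
local notation "Idx" => Index (Fin 3)

namespace Datum

variable {D : Datum} (h : D.Valid)
include h

/-! ## The fast product: `∂ₜ(η²ψ̃²) = μ' (k·∇)(η²ψ̃²)` -/

/-- `(k_x·∇)(η²ψ̃²) = 2 σ |k_x|² η η' ψ̃²`. [folklore] -/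
theorem dirD_fastF (x : Idx) (t : ℝ) (y : 𝕋³) :
    dirD x (Jet.fastF (D.J x) D.s x t) y =
      2 * ((D.σ : ℝ) * dirNormSq x) * (Jet.eta (D.J x) x t y * Jet.etaD (D.J x) x t y) * Jet.psiJ (D.J x) D.s x y ^ 2 := by
  have hJ := Jvalid h x
  have hη : Torus.IsSmooth (Jet.eta (D.J x) x t) := Jet.isSmooth_eta hJ x t
  have hψ : Torus.IsSmooth (Jet.psiJ (D.J x) D.s x) := isSmooth_psiJ h x
  have h1η : Torus.IsContDiff 1 (Jet.eta (D.J x) x t) := hη.isContDiff (by simp)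
  have h1ψ : Torus.IsContDiff 1 (Jet.psiJ (D.J x) D.s x) := hψ.isContDiff (by simp)
  have hη2 : Torus.IsSmooth (fun z => Jet.eta (D.J x) x t z * Jet.eta (D.J x) x t z) := hη.mul hη
  have hψ2 : Torus.IsSmooth (fun z => Jet.psiJ (D.J x) D.s x z * Jet.psiJ (D.J x) D.s x z) := hψ.mul hψ
  have e : Jet.fastF (D.J x) D.s x t = fun z => (Jet.eta (D.J x) x t z * Jet.eta (D.J x) x t z) *
      (Jet.psiJ (D.J x) D.s x z * Jet.psiJ (D.J x) D.s x z) := by funext z; simp only [Jet.fastF, sq]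
  rw [e, dirD_mul x (hη2.isContDiff (by simp)) (hψ2.isContDiff (by simp)), dirD_mul x h1ψ h1ψ, dirD_mul x h1η h1η,
    Jet.dirD_psiJ D.s hJ x y, Jet.dirD_eta hJ x t y, sum_sq_dir]
  have : ((D.J x).σ : ℝ) = D.σ := rfl
  rw [this]; ring

/-- **`∂ₜ(η²ψ̃²) = μ' (k·∇)(η²ψ̃²)`** (`ω_x = |k_x|² σ μ'`). [cite: BuckmasterVicol2020, §7.4 (7.20)] -/
theorem hasDerivAt_fastF (x : Idx) (t : ℝ) (y : 𝕋³) :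
    HasDerivAt (fun t' => Jet.fastF (D.J x) D.s x t' y) (D.mup * dirD x (Jet.fastF (D.J x) D.s x t) y) t := by
  have hJ := Jvalid h x
  have hη := Jet.hasDerivAt_eta hJ x y t
  have h2 : HasDerivAt (fun t' => Jet.eta (D.J x) x t' y ^ 2 * Jet.psiJ (D.J x) D.s x y ^ 2)
      ((2 * Jet.eta (D.J x) x t y * ((D.J x).om * Jet.etaD (D.J x) x t y)) * Jet.psiJ (D.J x) D.s x y ^ 2) t := by
    have := (hη.pow 2).mul_const (Jet.psiJ (D.J x) D.s x y ^ 2)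
    simpa using this
  refine h2.congr_deriv ?_
  rw [dirD_fastF h, J_om]
  ring

/-! ## `w^{(p)} ⊗ w^{(p)}` and its divergence -/

/-- **Disjoint supports kill the cross terms**: `w^{(p)} ⊗ w^{(p)} = ∑_x F_x k_x ⊗ k_x`. [cite: BuckmasterVicol2020, §7.5.3 (7.34)] -/
theorem tensorProd_wp (t : ℝ) (y : 𝕋³) (j : Fin 3) :
    Torus.tensorProd (D.wp t) (D.wp t) y j = ∑ x, (D.F x t y * (dir x j : ℝ)) • dirVec x := by
  simp only [Torus.tensorProd, wp]
  rw [show (∑ x, D.a x t y • Jet.W (D.J x) D.s x t y) j = ∑ x, (D.a x t y • Jet.W (D.J x) D.s x t y) j from by simp [Finset.sum_apply],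
    Finset.sum_smul]
  refine Finset.sum_congr rfl fun x _ => ?_
  rw [Finset.smul_sum, ← Finset.sum_erase_add _ _ (Finset.mem_univ x)]
  have hzero : ∑ x' ∈ Finset.univ.erase x, (D.a x t y • Jet.W (D.J x) D.s x t y) j • (D.a x' t y • Jet.W (D.J x') D.s x' t y) = 0 := by
    refine Finset.sum_eq_zero fun x' hx' => ?_
    have hne : x' ≠ x := Finset.ne_of_mem_erase hx'
    have h0 := psiJ_mul_psiJ h (Ne.symm hne) y
    simp only [Jet.W, PiLp.smul_apply, smul_eq_mul, smul_smul]
    rw [show D.a x t y * (Jet.eta (D.J x) x t y * Jet.psiJ (D.J x) D.s x y) * (dirVec x) j *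
        (D.a x' t y * (Jet.eta (D.J x') x' t y * Jet.psiJ (D.J x') D.s x' y)) =
        (D.a x t y * Jet.eta (D.J x) x t y * (dirVec x) j * D.a x' t y * Jet.eta (D.J x') x' t y) *
          (Jet.psiJ (D.J x) D.s x y * Jet.psiJ (D.J x') D.s x' y) by ring, h0, mul_zero, zero_smul]
  rw [hzero, zero_add]
  simp only [Jet.W, PiLp.smul_apply, smul_eq_mul, smul_smul, F, Jet.fastF]
  congr 1
  simp only [dirVec, PiLp.toLp_apply]
  ring

/-- `F_x(t)` is smooth; `wp(t)` is smooth. [folklore] -/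
theorem isSmooth_wp {t : ℝ} (ht : t ∈ Icc 0 D.T) : Torus.IsSmooth (D.wp t) := (smooth_wp h).isSmooth_slice ht

omit h in
/-- `div (∑_x (c_x kⱼ) k_x columns) = ∑_x ((k_x·∇)c_x) k_x` for smooth scalars `c_x`. [folklore] -/
theorem tensorDivergence_sum_dir {c : Idx → 𝕋³ → ℝ} (hc : ∀ x, Torus.IsSmooth (c x)) (y : 𝕋³) :
    Torus.tensorDivergence (fun z j => ∑ x, (c x z * (dir x j : ℝ)) • dirVec x) y = ∑ x, dirD x (c x) y • dirVec x := by
  unfold Torus.tensorDivergence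
  have hcx : ∀ x j, Torus.IsSmooth (fun z => c x z * (dir x j : ℝ)) := fun x j => (hc x).mul (Torus.isSmooth_const _)
  have hterm : ∀ x j, Torus.IsSmooth (fun z => (c x z * (dir x j : ℝ)) • dirVec x) := fun x j =>
    (hcx x j).smul' (Torus.isSmooth_const _)
  have e1 : ∀ j, Torus.partialDeriv j (fun z => ∑ x, (c x z * (dir x j : ℝ)) • dirVec x) y =
      ∑ x, Torus.partialDeriv j (fun z => (c x z * (dir x j : ℝ)) • dirVec x) y := fun j => by
    rw [show (fun z => ∑ x, (c x z * (dir x j : ℝ)) • dirVec x) = fun z => ∑ x ∈ Finset.univ, (c x z * (dir x j : ℝ)) • dirVec x from rfl,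
      Torus.partialDeriv_finset_sum Finset.univ (fun x _ => (hterm x j).isContDiff (by simp))]
  simp_rw [e1]
  rw [Finset.sum_comm]
  refine Finset.sum_congr rfl fun x _ => ?_
  have e2 : ∀ j, Torus.partialDeriv j (fun z => (c x z * (dir x j : ℝ)) • dirVec x) y = ((dir x j : ℝ) * Torus.partialDeriv j (c x) y) • dirVec x := by
    intro j
    rw [Torus.partialDeriv_smul ((hcx x j).isContDiff (by simp)) (Torus.isContDiff_const _),
      Torus.partialDeriv_const_apply, smul_zero, zero_add,
      Torus.partialDeriv_mul ((hc x).isContDiff (by simp)) (Torus.isContDiff_const _), Torus.partialDeriv_const_apply]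
    congr 1; ring
  simp_rw [e2]
  rw [← Finset.sum_smul, dirD]

/-- **`div (w^{(p)} ⊗ w^{(p)}) = ∑_x ((k_x·∇)F_x) k_x`**. [cite: BuckmasterVicol2020, §7.6.3 (7.55)] -/
theorem tensorDivergence_tensorProd_wp {t : ℝ} (ht : t ∈ Icc 0 D.T) (y : 𝕋³) :
    Torus.tensorDivergence (Torus.tensorProd (D.wp t) (D.wp t)) y = ∑ x, dirD x (D.F x t) y • dirVec x := by
  have e : Torus.tensorProd (D.wp t) (D.wp t) = fun z j => ∑ x, (D.F x t z * (dir x j : ℝ)) • dirVec x :=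
    funext fun z => funext fun j => tensorProd_wp h t z j
  rw [e, tensorDivergence_sum_dir (fun x => isSmooth_F h x ht)]

/-! ## The cancelled stress: `M = ρ Id - ∑_x a_x² k_x ⊗ k_x` -/

/-- **`M = ρ Id - ∑_x hsq_x k_x ⊗ k_x`** by columns (the key identity of the geometric lemma). [cite: BuckmasterVicol2020, §7.5.1 (7.30)] -/
theorem M_eq {t : ℝ} (ht : t ∈ Icc 0 D.T) (y : 𝕋³) (j : Fin 3) :
    D.M t y j = JAmp.rho D.γ₀ D.M t y • EuclideanSpace.single j (1 : ℝ) -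
      ∑ x, (JAmp.hsq D.γ₀ D.M x t y * (dir x j : ℝ)) • dirVec x := by
  ext i
  have hkey := JAmp.sum_hsq_mul_dir (γ₀ := D.γ₀) (R := D.M) hd3 h.hγ (h.hMsym t ht y) i j
  simp only [PiLp.sub_apply, PiLp.smul_apply, smul_eq_mul, PiLp.single_apply]
  rw [show (∑ x, (JAmp.hsq D.γ₀ D.M x t y * (dir x j : ℝ)) • dirVec x) i =
      ∑ x, ((JAmp.hsq D.γ₀ D.M x t y * (dir x j : ℝ)) • dirVec x) i from by simp [Finset.sum_apply]]
  simp only [PiLp.smul_apply, smul_eq_mul, dirVec]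
  have e : ∑ x, JAmp.hsq D.γ₀ D.M x t y * (dir x j : ℝ) * (dir x i : ℝ) =
      ∑ x, JAmp.hsq D.γ₀ D.M x t y * ((dir x i : ℝ) * (dir x j : ℝ)) := Finset.sum_congr rfl fun x _ => by ring
  rw [e, hkey]
  by_cases hij : i = j
  · subst hij; simp
  · simp [hij]

/-- **`div M = ∇ρ - ∑_x ((k_x·∇)hsq_x) k_x`**. [folklore] -/
theorem tensorDivergence_M {t : ℝ} (ht : t ∈ Icc 0 D.T) (y : 𝕋³) :
    Torus.tensorDivergence (D.M t) y = Torus.gradient (JAmp.rho D.γ₀ D.M t) y -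
      ∑ x, dirD x (JAmp.hsq D.γ₀ D.M x t) y • dirVec x := by
  have hρ : Torus.IsSmooth (JAmp.rho D.γ₀ D.M t) := (JAmp.isSmoothSpaceTimeOn_rho h.hγ h.hM).isSmooth_slice ht
  have hh : ∀ x, Torus.IsSmooth (JAmp.hsq D.γ₀ D.M x t) := fun x => (smooth_hsq h x).isSmooth_slice ht
  have hA : Torus.IsSmooth (fun z j => JAmp.rho D.γ₀ D.M t z • EuclideanSpace.single j (1 : ℝ)) :=
    Torus.isSmooth_tensor fun j => hρ.smul' (Torus.isSmooth_const _)
  have hB : Torus.IsSmooth (fun z j => ∑ x, (JAmp.hsq D.γ₀ D.M x t z * (dir x j : ℝ)) • dirVec x) :=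
    Torus.isSmooth_tensor fun j => Torus.isSmooth_finset_sum _ fun x _ => by
      have h1 : Torus.IsSmooth (fun z => JAmp.hsq D.γ₀ D.M x t z * (dir x j : ℝ)) := (hh x).mul (Torus.isSmooth_const _)
      exact h1.smul' (Torus.isSmooth_const _)
  have e : D.M t = fun z j => JAmp.rho D.γ₀ D.M t z • EuclideanSpace.single j (1 : ℝ) -
      ∑ x, (JAmp.hsq D.γ₀ D.M x t z * (dir x j : ℝ)) • dirVec x := funext fun z => funext fun j => M_eq h ht z j
  rw [e, Torus.tensorDivergence_sub hA hB, Torus.tensorDivergence_smul_single (hρ.isContDiff (by simp)), tensorDivergence_sum_dir hh]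

/-! ## The oscillation potential `Ψ_x = Δ⁻¹(η²ψ̃² - 1)` -/

/-- **The oscillation potential** `Ψ_x(t) = Δ⁻¹(η_x²ψ̃_x² - 1)`. [cite: BuckmasterVicol2020, §7.6.3 (7.56)] -/
def Psi (D : Datum) (x : Idx) (t : ℝ) : 𝕋³ → ℝ := Torus.invLaplacian (fun z => Jet.fastF (D.J x) D.s x t z - 1)

/-- The oscillation coefficient field `c_x = ((k_x·∇)hsq_x) k_x`. [folklore] -/
def cvec (D : Datum) (x : Idx) (t : ℝ) : 𝕋³ → E³ := fun z => dirD x (JAmp.hsq D.γ₀ D.M x t) z • dirVec x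

/-- Smoothness / admissibility bookkeeping. [folklore] -/
theorem smooth_Psi (x : Idx) : Torus.IsSmoothSpaceTimeOn (Icc 0 D.T) (D.Psi x) :=
  ((smooth_fastF h x).sub (Torus.isSmoothSpaceTimeOn_const (Torus.isSmooth_const _) _)).invLaplacian (convex (D := D))
    (interior_nonempty h)

/-- Smoothness / admissibility bookkeeping. [folklore] -/
theorem isSmooth_Psi (x : Idx) {t : ℝ} (ht : t ∈ Icc 0 D.T) : Torus.IsSmooth (D.Psi x t) := (smooth_Psi h x).isSmooth_slice ht

/-- `ΔΨ_x = η²ψ̃² - 1` (`∫η²ψ̃² = 1`). [folklore] -/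
theorem laplacian_Psi (x : Idx) {t : ℝ} (ht : t ∈ Icc 0 D.T) (y : 𝕋³) :
    Torus.laplacian (D.Psi x t) y = Jet.fastF (D.J x) D.s x t y - 1 := by
  have hf : Torus.IsSmooth (Jet.fastF (D.J x) D.s x t) := (smooth_fastF h x).isSmooth_slice ht
  have hf1 : Torus.IsSmooth (fun z => Jet.fastF (D.J x) D.s x t z - 1) := hf.sub (Torus.isSmooth_const _)
  rw [Psi, Torus.laplacian_invLaplacian hf1,
    integral_sub hf.integrable (integrable_const _), Jet.integral_fastF D.s (Jvalid h x) hd3 x t]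
  simp

/-- Smoothness / admissibility bookkeeping. [folklore] -/
theorem smooth_dirD_hsq (x : Idx) : Torus.IsSmoothSpaceTimeOn (Icc 0 D.T) (fun t z => dirD x (JAmp.hsq D.γ₀ D.M x t) z) :=
  Torus.IsSmoothSpaceTimeOn.sum fun j _ =>
    (Torus.isSmoothSpaceTimeOn_const (Torus.isSmooth_const _) _).mul ((smooth_hsq h x).partialDeriv (uniqueDiffOn h) j)

/-- Smoothness / admissibility bookkeeping. [folklore] -/
theorem smooth_cvec (x : Idx) : Torus.IsSmoothSpaceTimeOn (Icc 0 D.T) (D.cvec x) :=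
  (smooth_dirD_hsq h x).smul (Torus.isSmoothSpaceTimeOn_const (Torus.isSmooth_const _) _)

/-- Smoothness / admissibility bookkeeping. [folklore] -/
theorem isSmooth_cvec (x : Idx) {t : ℝ} (ht : t ∈ Icc 0 D.T) : Torus.IsSmooth (D.cvec x t) := (smooth_cvec h x).isSmooth_slice ht

/-- **The oscillation expansion**: `((k·∇)hsq)(η²ψ̃² - 1) k = div S_osc - ∇π_osc - r_osc`. [cite: BuckmasterVicol2020, §7.6.3 (7.55)–(7.56)] -/
theorem oscillation_expansion (x : Idx) {t : ℝ} (ht : t ∈ Icc 0 D.T) (y : 𝕋³) :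
    (dirD x (JAmp.hsq D.γ₀ D.M x t) y * (Jet.fastF (D.J x) D.s x t y - 1)) • dirVec x =
      Torus.tensorDivergence (Torus.expansionTensor (D.cvec x t) (D.Psi x t)) y -
        Torus.gradient (Torus.expansionPressure (D.cvec x t) (D.Psi x t)) y -
        Torus.expansionRemainder (D.cvec x t) (D.Psi x t) y := by
  rw [← Torus.laplacian_smul_eq_expansion' (isSmooth_cvec h x ht) (isSmooth_Psi h x ht) y, laplacian_Psi h x ht, cvec, smul_smul,
    mul_comm]

/-! ## Time derivatives -/

/-- The one-sided time derivative of `F_x`. [folklore] -/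
def Fdot (D : Datum) (x : Idx) (t : ℝ) (y : 𝕋³) : ℝ := Torus.timeDerivWithin (Icc 0 D.T) (D.F x) t y

/-- The one-sided time derivative of `hsq_x`. [folklore] -/
def hdot (D : Datum) (x : Idx) (t : ℝ) (y : 𝕋³) : ℝ := Torus.timeDerivWithin (Icc 0 D.T) (JAmp.hsq D.γ₀ D.M x) t y

/-- **`∂ₜF_x = (∂ₜhsq_x) η²ψ̃² + hsq_x μ' (k_x·∇)(η²ψ̃²)`**. [cite: BuckmasterVicol2020, §7.6.3 (7.57)] -/
theorem hasDerivWithinAt_F (x : Idx) {t : ℝ} (ht : t ∈ Icc 0 D.T) (y : 𝕋³) :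
    HasDerivWithinAt (fun s => D.F x s y)
      (D.hdot x t y * Jet.fastF (D.J x) D.s x t y + JAmp.hsq D.γ₀ D.M x t y * (D.mup * dirD x (Jet.fastF (D.J x) D.s x t) y))
      (Icc 0 D.T) t := by
  have e : (fun s => D.F x s y) = fun s => JAmp.hsq D.γ₀ D.M x s y * Jet.fastF (D.J x) D.s x s y := by funext s; rw [F, a_sq h]
  rw [e]
  exact ((smooth_hsq h x).hasDerivWithinAt_slice ht y).mul (hasDerivAt_fastF h x t y).hasDerivWithinAt

/-- Smoothness / admissibility bookkeeping. [folklore] -/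
theorem Fdot_eq (x : Idx) {t : ℝ} (ht : t ∈ Icc 0 D.T) (y : 𝕋³) :
    D.Fdot x t y = D.hdot x t y * Jet.fastF (D.J x) D.s x t y + JAmp.hsq D.γ₀ D.M x t y * (D.mup * dirD x (Jet.fastF (D.J x) D.s x t) y) :=
  (hasDerivWithinAt_F h x ht y).derivWithin (uniqueDiffOn h t ht)

/-- **`∂ₜX = -∑_x (μ')⁻¹ (∂ₜF_x - ∫∂ₜF_x) k_x`**. [folklore] -/
theorem timeDerivWithin_X {t : ℝ} (ht : t ∈ Icc 0 D.T) (y : 𝕋³) :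
    Torus.timeDerivWithin (Icc 0 D.T) D.X t y = -∑ x, (D.mup⁻¹ * (D.Fdot x t y - ∫ z, D.Fdot x t z)) • dirVec x := by
  have hterm : ∀ x, HasDerivWithinAt (fun s => (D.mup⁻¹ * (D.F x s y - ∫ z, D.F x s z)) • dirVec x)
      ((D.mup⁻¹ * (D.Fdot x t y - ∫ z, D.Fdot x t z)) • dirVec x) (Icc 0 D.T) t := fun x =>
    ((((smooth_F h x).hasDerivWithinAt_slice ht y).sub ((smooth_F h x).hasDerivWithinAt_integral (convex (D := D)) ht)).const_mul _).smul_const _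
  have hsum := HasDerivWithinAt.fun_sum (u := Finset.univ) fun x _ => hterm x
  have hX : HasDerivWithinAt (fun s => D.X s y) (-∑ x, (D.mup⁻¹ * (D.Fdot x t y - ∫ z, D.Fdot x t z)) • dirVec x) (Icc 0 D.T) t := by
    have e : (fun s => D.X s y) = fun s => -(∑ x ∈ Finset.univ, (D.mup⁻¹ * (D.F x s y - ∫ z, D.F x s z)) • dirVec x) := rfl
    rw [e]; exact hsum.neg
  exact hX.derivWithin (uniqueDiffOn h t ht)

omit h in
/-- `∂ₜ∇ = ∇∂ₜ` for jointly smooth scalars on an interval. [folklore] -/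
theorem timeDerivWithin_gradient_comm {a b : ℝ} (hab : a < b) {u : ℝ → 𝕋³ → ℝ} (hu : Torus.IsSmoothSpaceTimeOn (Icc a b) u)
    {t : ℝ} (ht : t ∈ Icc a b) (y : 𝕋³) :
    Torus.timeDerivWithin (Icc a b) (fun s z => Torus.gradient (u s) z) t y = Torus.gradient (Torus.timeDerivWithin (Icc a b) u t) y := by
  have hU : UniqueDiffOn ℝ (Icc a b) := uniqueDiffOn_Icc hab
  have hg : Torus.IsSmoothSpaceTimeOn (Icc a b) (fun s z => Torus.gradient (u s) z) := hu.gradient hU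
  have hdt : Torus.IsSmooth (Torus.timeDerivWithin (Icc a b) u t) := hu.isSmooth_timeDerivWithin hU ht
  ext i
  have h1 : (Torus.timeDerivWithin (Icc a b) (fun s z => Torus.gradient (u s) z) t y) i =
      Torus.timeDerivWithin (Icc a b) (fun s z => Torus.gradient (u s) z i) t y :=
    (Torus.timeDerivWithin_clm_comp hg hU (EuclideanSpace.proj i) ht y).symm
  rw [h1, Torus.gradient_apply (hdt.isContDiff (by simp)), ← Torus.timeDerivWithin_partialDeriv_comm hab hu ht i y]
  -- the two slice functions agree on the interval
  unfold Torus.timeDerivWithin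
  refine derivWithin_congr (fun s hs => ?_) ?_
  · exact Torus.gradient_apply ((hu.isSmooth_slice hs).isContDiff (by simp)) y i
  · exact Torus.gradient_apply ((hu.isSmooth_slice ht).isContDiff (by simp)) y i

/-- The time derivative of `ζ`. [folklore] -/
def zetadot (D : Datum) (t : ℝ) : 𝕋³ → ℝ := Torus.timeDerivWithin (Icc 0 D.T) D.zeta t

/-- **`∂ₜw = ∂ₜwpc + ∂ₜX + ∇∂ₜζ`**. [folklore] -/
theorem timeDerivWithin_w {t : ℝ} (ht : t ∈ Icc 0 D.T) (y : 𝕋³) :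
    Torus.timeDerivWithin (Icc 0 D.T) D.w t y = Torus.timeDerivWithin (Icc 0 D.T) D.wpc t y +
      Torus.timeDerivWithin (Icc 0 D.T) D.X t y + Torus.gradient (D.zetadot t) y := by
  have hU := uniqueDiffOn h
  rw [show D.w = fun s z => D.w' s z + Torus.gradient (D.zeta s) z from rfl,
    Torus.timeDerivWithin_add (smooth_w' h) ((smooth_zeta h).gradient hU) hU ht,
    show D.w' = fun s z => D.wpc s z + D.X s z from rfl, Torus.timeDerivWithin_add (smooth_wpc h) (smooth_X h) hU ht,
    timeDerivWithin_gradient_comm h.hT (smooth_zeta h) ht]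
  rfl

/-! ## The identity `(⋆)` -/

/-- `w - w^{(p)}` (the correctors). [folklore] -/
def wr (D : Datum) (t : ℝ) (y : 𝕋³) : E³ := D.w t y - D.wp t y

/-- The cross tensor `wp ⊗ wr + wr ⊗ wp + wr ⊗ wr`. [cite: BuckmasterVicol2020, §7.6.3 (7.54)] -/
def cross (D : Datum) (t : ℝ) : 𝕋³ → Fin 3 → E³ := fun y j =>
  Torus.tensorProd (D.wp t) (D.wr t) y j + Torus.tensorProd (D.wr t) (D.wp t) y j + Torus.tensorProd (D.wr t) (D.wr t) y j

/-- The oscillation tensor `∑_x S_osc,x`. [cite: BuckmasterVicol2020, §7.6.3 (7.56)] -/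
def Sosc (D : Datum) (t : ℝ) : 𝕋³ → Fin 3 → E³ := fun y j => ∑ x, Torus.expansionTensor (D.cvec x t) (D.Psi x t) y j

/-- **The tensor `S₁` of `(⋆)`**: carried stress + cross terms + oscillation tensors. [folklore] -/
def S₁ (D : Datum) (Rc : ℝ → 𝕋³ → Fin 3 → E³) (t : ℝ) : 𝕋³ → Fin 3 → E³ := fun y j => Rc t y j + D.cross t y j + D.Sosc t y j

/-- **The scalar `q` of `(⋆)`**: `∂ₜζ + ρ - tr M/3 - ∑_x π_osc,x`. [folklore] -/
def qfun (D : Datum) (t : ℝ) (y : 𝕋³) : ℝ :=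
  D.zetadot t y + JAmp.rho D.γ₀ D.M t y - Torus.tensorTrace (D.M t) y / 3 - ∑ x, Torus.expansionPressure (D.cvec x t) (D.Psi x t) y

/-- The linear-in-time source `f₁ = ∂ₜ wpc`. [folklore] -/
def f₁ (D : Datum) (t : ℝ) (y : 𝕋³) : E³ := Torus.timeDerivWithin (Icc 0 D.T) D.wpc t y

/-- The oscillation remainder source `f₂ = -∑_x r_osc,x`. [folklore] -/
def f₂ (D : Datum) (t : ℝ) (y : 𝕋³) : E³ := -∑ x, Torus.expansionRemainder (D.cvec x t) (D.Psi x t) y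

/-- The slow-time source `f₃ = -∑_x (μ')⁻¹ (∂ₜhsq_x) η²ψ̃² k_x`. [folklore] -/
def f₃ (D : Datum) (t : ℝ) (y : 𝕋³) : E³ := -∑ x, (D.mup⁻¹ * (D.hdot x t y * Jet.fastF (D.J x) D.s x t y)) • dirVec x

/-- The space-constant source `f₄ = ∑_x (μ')⁻¹ (∫∂ₜF_x) k_x`. [folklore] -/
def f₄ (D : Datum) (t : ℝ) : E³ := ∑ x, (D.mup⁻¹ * ∫ z, D.Fdot x t z) • dirVec x

/-- **The source `f` of `(⋆)`**. [folklore] -/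
def ffun (D : Datum) (t : ℝ) (y : 𝕋³) : E³ := D.f₁ t y + D.f₂ t y + D.f₃ t y + D.f₄ t

/-! ### Smoothness of the pieces -/

/-- Smoothness / admissibility bookkeeping. [folklore] -/
theorem smooth_wr : Torus.IsSmoothSpaceTimeOn (Icc 0 D.T) D.wr := (smooth_w h).sub (smooth_wp h)

/-- Smoothness / admissibility bookkeeping. [folklore] -/
theorem isSmooth_wr {t : ℝ} (ht : t ∈ Icc 0 D.T) : Torus.IsSmooth (D.wr t) := (smooth_wr h).isSmooth_slice ht

/-- Smoothness / admissibility bookkeeping. [folklore] -/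
theorem isSmooth_cross {t : ℝ} (ht : t ∈ Icc 0 D.T) : Torus.IsSmooth (D.cross t) :=
  (((isSmooth_wp h ht).tensorProd (isSmooth_wr h ht)).add ((isSmooth_wr h ht).tensorProd (isSmooth_wp h ht))).add
    ((isSmooth_wr h ht).tensorProd (isSmooth_wr h ht))

/-- Smoothness / admissibility bookkeeping. [folklore] -/
theorem isSmooth_Sosc_term (x : Idx) {t : ℝ} (ht : t ∈ Icc 0 D.T) : Torus.IsSmooth (Torus.expansionTensor (D.cvec x t) (D.Psi x t)) :=
  Torus.isSmooth_expansionTensor (isSmooth_cvec h x ht) (isSmooth_Psi h x ht)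

/-- Smoothness / admissibility bookkeeping. [folklore] -/
theorem isSmooth_Sosc {t : ℝ} (ht : t ∈ Icc 0 D.T) : Torus.IsSmooth (D.Sosc t) :=
  CL22.Datum.isSmooth_tensor_finset_sum _ fun x _ => isSmooth_Sosc_term h x ht

/-- **The identity `(⋆)`**: for any jointly smooth carried stress `R_c`,
`∂ₜw + div(w ⊗ w) + div(R_c + M̊) = div S₁ + ∇q + f` on `[0, T] × 𝕋³`. [cite: BuckmasterVicol2020, §7.6 (7.47)] -/
theorem star {Rc : ℝ → 𝕋³ → Fin 3 → E³} (hRc : Torus.IsSmoothSpaceTimeOn (Icc 0 D.T) Rc) {t : ℝ} (ht : t ∈ Icc 0 D.T) (y : 𝕋³) :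
    Torus.timeDerivWithin (Icc 0 D.T) D.w t y + Torus.tensorDivergence (Torus.tensorProd (D.w t) (D.w t)) y +
      Torus.tensorDivergence (fun z j => Rc t z j + Torus.traceless (D.M t) z j) y =
    Torus.tensorDivergence (D.S₁ Rc t) y + Torus.gradient (D.qfun t) y + D.ffun t y := by
  -- smoothness at time `t`
  have hwp := isSmooth_wp h ht
  have hwr := isSmooth_wr h ht
  have hM : Torus.IsSmooth (D.M t) := h.hM.isSmooth_slice ht
  have hRct : Torus.IsSmooth (Rc t) := hRc.isSmooth_slice ht
  have hρ : Torus.IsSmooth (JAmp.rho D.γ₀ D.M t) := (JAmp.isSmoothSpaceTimeOn_rho h.hγ h.hM).isSmooth_slice ht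
  have hh : ∀ x, Torus.IsSmooth (JAmp.hsq D.γ₀ D.M x t) := fun x => (smooth_hsq h x).isSmooth_slice ht
  have hfF : ∀ x, Torus.IsSmooth (Jet.fastF (D.J x) D.s x t) := fun x => (smooth_fastF h x).isSmooth_slice ht
  have hζd : Torus.IsSmooth (D.zetadot t) := (smooth_zeta h).isSmooth_timeDerivWithin (uniqueDiffOn h) ht
  have hπ : ∀ x, Torus.IsSmooth (Torus.expansionPressure (D.cvec x t) (D.Psi x t)) := fun x =>
    Torus.isSmooth_expansionPressure (isSmooth_cvec h x ht) (isSmooth_Psi h x ht)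
  have htr : Torus.IsSmooth (fun z => Torus.tensorTrace (D.M t) z / 3) := hM.tensorTrace.div_const _
  -- (1) the time derivative
  have e1 := timeDerivWithin_w h ht y
  have e1X := timeDerivWithin_X h ht y
  -- (2) the transport: `w ⊗ w = wp ⊗ wp + cross`
  have ecross : Torus.tensorProd (D.w t) (D.w t) = fun z j => Torus.tensorProd (D.wp t) (D.wp t) z j + D.cross t z j := by
    funext z j
    have ew : D.w t z = D.wp t z + D.wr t z := by simp [wr]
    simp only [Torus.tensorProd, cross, ew, PiLp.add_apply, add_smul, smul_add]
    abel
  have e2 : Torus.tensorDivergence (Torus.tensorProd (D.w t) (D.w t)) y =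
      ∑ x, dirD x (D.F x t) y • dirVec x + Torus.tensorDivergence (D.cross t) y := by
    rw [ecross, Torus.tensorDivergence_add_apply ((hwp.tensorProd hwp).isContDiff (by simp)) ((isSmooth_cross h ht).isContDiff (by simp)),
      tensorDivergence_tensorProd_wp h ht]
  have eF : ∀ x, dirD x (D.F x t) y = JAmp.hsq D.γ₀ D.M x t y * dirD x (Jet.fastF (D.J x) D.s x t) y +
      Jet.fastF (D.J x) D.s x t y * dirD x (JAmp.hsq D.γ₀ D.M x t) y := by
    intro x
    have e : D.F x t = fun z => JAmp.hsq D.γ₀ D.M x t z * Jet.fastF (D.J x) D.s x t z := by funext z; rw [F, a_sq h]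
    rw [e, dirD_mul x ((hh x).isContDiff (by simp)) ((hfF x).isContDiff (by simp))]
  -- (3) the old stress
  have e3 : Torus.tensorDivergence (fun z j => Rc t z j + Torus.traceless (D.M t) z j) y =
      Torus.tensorDivergence (Rc t) y + (Torus.gradient (JAmp.rho D.γ₀ D.M t) y - ∑ x, dirD x (JAmp.hsq D.γ₀ D.M x t) y • dirVec x) -
        Torus.gradient (fun z => Torus.tensorTrace (D.M t) z / 3) y := by
    rw [Torus.tensorDivergence_add_apply (hRct.isContDiff (by simp)) (hM.traceless.isContDiff (by simp)), Torus.tensorDivergence_traceless hM,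
      tensorDivergence_M h ht]
    simp only [Fintype.card_fin, Nat.cast_ofNat]
    abel
  -- (4) the oscillation expansion, summed
  have e4 : ∑ x, (dirD x (JAmp.hsq D.γ₀ D.M x t) y * (Jet.fastF (D.J x) D.s x t y - 1)) • dirVec x =
      Torus.tensorDivergence (D.Sosc t) y - Torus.gradient (fun z => ∑ x, Torus.expansionPressure (D.cvec x t) (D.Psi x t) z) y +
        D.f₂ t y := by
    simp_rw [oscillation_expansion h _ ht y]
    rw [Finset.sum_sub_distrib, Finset.sum_sub_distrib, f₂,
      show D.Sosc t = fun z j => ∑ x ∈ Finset.univ, Torus.expansionTensor (D.cvec x t) (D.Psi x t) z j from rfl,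
      CL22.Datum.tensorDivergence_finset_sum_apply _ (fun x _ => isSmooth_Sosc_term h x ht),
      show (fun z => ∑ x, Torus.expansionPressure (D.cvec x t) (D.Psi x t) z) =
        fun z => ∑ x ∈ Finset.univ, Torus.expansionPressure (D.cvec x t) (D.Psi x t) z from rfl,
      CL22.Datum.gradient_finset_sum_apply _ (fun x _ => hπ x)]
    abel
  -- (5) the right-hand side
  have e5 : Torus.tensorDivergence (D.S₁ Rc t) y = Torus.tensorDivergence (Rc t) y + Torus.tensorDivergence (D.cross t) y +
      Torus.tensorDivergence (D.Sosc t) y := by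
    have hA : Torus.IsSmooth (fun z j => Rc t z j + D.cross t z j) := hRct.add (isSmooth_cross h ht)
    rw [show D.S₁ Rc t = fun z j => (Rc t z j + D.cross t z j) + D.Sosc t z j from rfl,
      Torus.tensorDivergence_add_apply (hA.isContDiff (by simp)) ((isSmooth_Sosc h ht).isContDiff (by simp)),
      Torus.tensorDivergence_add_apply (hRct.isContDiff (by simp)) ((isSmooth_cross h ht).isContDiff (by simp))]
  have e6 : Torus.gradient (D.qfun t) y = Torus.gradient (D.zetadot t) y + Torus.gradient (JAmp.rho D.γ₀ D.M t) y -
      Torus.gradient (fun z => Torus.tensorTrace (D.M t) z / 3) y -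
      Torus.gradient (fun z => ∑ x, Torus.expansionPressure (D.cvec x t) (D.Psi x t) z) y := by
    have hsumpi : Torus.IsSmooth (fun z => ∑ x, Torus.expansionPressure (D.cvec x t) (D.Psi x t) z) :=
      Torus.isSmooth_finset_sum _ fun x _ => hπ x
    have hA : Torus.IsSmooth (fun z => D.zetadot t z + JAmp.rho D.γ₀ D.M t z) := hζd.add hρ
    have hB : Torus.IsSmooth (fun z => D.zetadot t z + JAmp.rho D.γ₀ D.M t z - Torus.tensorTrace (D.M t) z / 3) := hA.sub htr
    rw [show D.qfun t = fun z => (D.zetadot t z + JAmp.rho D.γ₀ D.M t z - Torus.tensorTrace (D.M t) z / 3) -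
        ∑ x, Torus.expansionPressure (D.cvec x t) (D.Psi x t) z from rfl,
      CL22.Datum.gradient_sub_apply hB hsumpi, CL22.Datum.gradient_sub_apply hA htr,
      Torus.gradient_add_apply (hζd.isContDiff (by simp)) (hρ.isContDiff (by simp))]
  -- the sums over `x`
  have hsums : ∑ x, dirD x (D.F x t) y • dirVec x - ∑ x, (D.mup⁻¹ * (D.Fdot x t y - ∫ z, D.Fdot x t z)) • dirVec x -
      ∑ x, dirD x (JAmp.hsq D.γ₀ D.M x t) y • dirVec x =
      ∑ x, (dirD x (JAmp.hsq D.γ₀ D.M x t) y * (Jet.fastF (D.J x) D.s x t y - 1)) • dirVec x -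
      ∑ x, (D.mup⁻¹ * (D.hdot x t y * Jet.fastF (D.J x) D.s x t y)) • dirVec x +
      ∑ x, (D.mup⁻¹ * ∫ z, D.Fdot x t z) • dirVec x := by
    rw [← Finset.sum_sub_distrib, ← Finset.sum_sub_distrib, ← Finset.sum_sub_distrib, ← Finset.sum_add_distrib]
    refine Finset.sum_congr rfl fun x _ => ?_
    have hm : D.mup ≠ 0 := h.hmup.ne'
    rw [eF x, Fdot_eq h x ht y, ← sub_smul, ← sub_smul, ← sub_smul, ← add_smul]
    congr 1
    field_simp
    ring
  -- assemble
  rw [e1, e1X, e2, e3, e5, e6]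
  simp only [ffun, f₁, f₃, f₄]
  rw [← sub_eq_zero]
  calc _ = (∑ x, dirD x (D.F x t) y • dirVec x - ∑ x, (D.mup⁻¹ * (D.Fdot x t y - ∫ z, D.Fdot x t z)) • dirVec x -
        ∑ x, dirD x (JAmp.hsq D.γ₀ D.M x t) y • dirVec x) -
      (∑ x, (dirD x (JAmp.hsq D.γ₀ D.M x t) y * (Jet.fastF (D.J x) D.s x t y - 1)) • dirVec x -
        ∑ x, (D.mup⁻¹ * (D.hdot x t y * Jet.fastF (D.J x) D.s x t y)) • dirVec x +
        ∑ x, (D.mup⁻¹ * ∫ z, D.Fdot x t z) • dirVec x) -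
      ((Torus.tensorDivergence (D.Sosc t) y - Torus.gradient (fun z => ∑ x, Torus.expansionPressure (D.cvec x t) (D.Psi x t) z) y +
        D.f₂ t y) - ∑ x, (dirD x (JAmp.hsq D.γ₀ D.M x t) y * (Jet.fastF (D.J x) D.s x t y - 1)) • dirVec x) := by
        abel
    _ = 0 := by rw [hsums, ← e4, sub_self, sub_self, sub_self]

/-! ## Joint smoothness of the pieces of `(⋆)` and the new triple -/

omit h in
/-- Expansion tensors of jointly smooth data are jointly smooth. [folklore] -/
theorem smooth_expansionTensor' {S : Set ℝ} (hS : UniqueDiffOn ℝ S) {c : ℝ → 𝕋³ → E³} (hc : Torus.IsSmoothSpaceTimeOn S c)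
    {Φ : ℝ → 𝕋³ → ℝ} (hΦ : Torus.IsSmoothSpaceTimeOn S Φ) :
    Torus.IsSmoothSpaceTimeOn S (fun t => Torus.expansionTensor (c t) (Φ t)) :=
  Torus.isSmoothSpaceTimeOn_of_columns fun j => ((hΦ.partialDeriv hS j).smul hc).add ((hc.apply j).smul (hΦ.gradient hS))

omit h in
/-- Expansion pressures of jointly smooth data are jointly smooth. [folklore] -/
theorem smooth_expansionPressure' {S : Set ℝ} (hS : UniqueDiffOn ℝ S) {c : ℝ → 𝕋³ → E³} (hc : Torus.IsSmoothSpaceTimeOn S c)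
    {Φ : ℝ → 𝕋³ → ℝ} (hΦ : Torus.IsSmoothSpaceTimeOn S Φ) :
    Torus.IsSmoothSpaceTimeOn S (fun t => Torus.expansionPressure (c t) (Φ t)) :=
  hc.inner (hΦ.gradient hS)

omit h in
/-- Expansion remainders of jointly smooth data are jointly smooth. [folklore] -/
theorem smooth_expansionRemainder' {S : Set ℝ} (hS : UniqueDiffOn ℝ S) {c : ℝ → 𝕋³ → E³} (hc : Torus.IsSmoothSpaceTimeOn S c)
    {Φ : ℝ → 𝕋³ → ℝ} (hΦ : Torus.IsSmoothSpaceTimeOn S Φ) :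
    Torus.IsSmoothSpaceTimeOn S (fun t => Torus.expansionRemainder (c t) (Φ t)) := by
  refine Torus.IsSmoothSpaceTimeOn.sub (Torus.IsSmoothSpaceTimeOn.add ?_ ?_) ?_
  · exact Torus.IsSmoothSpaceTimeOn.sum fun j _ => (hΦ.partialDeriv hS j).smul (hc.partialDeriv hS j)
  · exact (hc.divergence hS).smul (hΦ.gradient hS)
  · exact Torus.IsSmoothSpaceTimeOn.sum fun j _ => ((hΦ.gradient hS).apply j).smul ((hc.apply j).gradient hS)

/-- Smoothness / admissibility bookkeeping. [folklore] -/
theorem smooth_cross : Torus.IsSmoothSpaceTimeOn (Icc 0 D.T) D.cross :=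
  (((smooth_wp h).tensorProd (smooth_wr h)).add ((smooth_wr h).tensorProd (smooth_wp h))).add ((smooth_wr h).tensorProd (smooth_wr h))

/-- Smoothness / admissibility bookkeeping. [folklore] -/
theorem smooth_Sosc : Torus.IsSmoothSpaceTimeOn (Icc 0 D.T) D.Sosc :=
  Torus.isSmoothSpaceTimeOn_of_columns fun j => Torus.IsSmoothSpaceTimeOn.sum fun x _ =>
    Torus.isSmoothSpaceTimeOn_pi.1 (smooth_expansionTensor' (uniqueDiffOn h) (smooth_cvec h x) (smooth_Psi h x)) j

/-- Smoothness / admissibility bookkeeping. [folklore] -/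
theorem smooth_S₁ {Rc : ℝ → 𝕋³ → Fin 3 → E³} (hRc : Torus.IsSmoothSpaceTimeOn (Icc 0 D.T) Rc) :
    Torus.IsSmoothSpaceTimeOn (Icc 0 D.T) (D.S₁ Rc) := (hRc.add (smooth_cross h)).add (smooth_Sosc h)

/-- Smoothness / admissibility bookkeeping. [folklore] -/
theorem smooth_zetadot : Torus.IsSmoothSpaceTimeOn (Icc 0 D.T) D.zetadot := (smooth_zeta h).timeDerivWithin (uniqueDiffOn h)

/-- Smoothness / admissibility bookkeeping. [folklore] -/
theorem smooth_qfun : Torus.IsSmoothSpaceTimeOn (Icc 0 D.T) D.qfun := by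
  have hρ := JAmp.isSmoothSpaceTimeOn_rho h.hγ h.hM (γ₀ := D.γ₀)
  have htr : Torus.IsSmoothSpaceTimeOn (Icc 0 D.T) (fun t z => Torus.tensorTrace (D.M t) z / 3) := h.hM.tensorTrace.div_const _
  have hπ : Torus.IsSmoothSpaceTimeOn (Icc 0 D.T) (fun t z => ∑ x, Torus.expansionPressure (D.cvec x t) (D.Psi x t) z) :=
    Torus.IsSmoothSpaceTimeOn.sum fun x _ => smooth_expansionPressure' (uniqueDiffOn h) (smooth_cvec h x) (smooth_Psi h x)
  exact (((smooth_zetadot h).add hρ).sub htr).sub hπ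

/-- Smoothness / admissibility bookkeeping. [folklore] -/
theorem smooth_hdot (x : Idx) : Torus.IsSmoothSpaceTimeOn (Icc 0 D.T) (D.hdot x) := (smooth_hsq h x).timeDerivWithin (uniqueDiffOn h)

/-- Smoothness / admissibility bookkeeping. [folklore] -/
theorem smooth_Fdot (x : Idx) : Torus.IsSmoothSpaceTimeOn (Icc 0 D.T) (D.Fdot x) := (smooth_F h x).timeDerivWithin (uniqueDiffOn h)

/-- Smoothness / admissibility bookkeeping. [folklore] -/
theorem smooth_f₁ : Torus.IsSmoothSpaceTimeOn (Icc 0 D.T) D.f₁ := (smooth_wpc h).timeDerivWithin (uniqueDiffOn h)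

/-- Smoothness / admissibility bookkeeping. [folklore] -/
theorem smooth_f₂ : Torus.IsSmoothSpaceTimeOn (Icc 0 D.T) D.f₂ :=
  (Torus.IsSmoothSpaceTimeOn.sum fun x _ => smooth_expansionRemainder' (uniqueDiffOn h) (smooth_cvec h x) (smooth_Psi h x)).neg

/-- Smoothness / admissibility bookkeeping. [folklore] -/
theorem smooth_f₃ : Torus.IsSmoothSpaceTimeOn (Icc 0 D.T) D.f₃ :=
  (Torus.IsSmoothSpaceTimeOn.sum fun x _ =>
    ((Torus.isSmoothSpaceTimeOn_const (Torus.isSmooth_const _) _).mul ((smooth_hdot h x).mul (smooth_fastF h x))).smul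
      (Torus.isSmoothSpaceTimeOn_const (Torus.isSmooth_const _) _)).neg

/-- Smoothness / admissibility bookkeeping. [folklore] -/
theorem smooth_f₄ : Torus.IsSmoothSpaceTimeOn (Icc 0 D.T) (fun t (_ : 𝕋³) => D.f₄ t) :=
  Torus.IsSmoothSpaceTimeOn.sum fun x _ =>
    ((Torus.isSmoothSpaceTimeOn_const (Torus.isSmooth_const _) _).mul ((smooth_Fdot h x).integral_const (uniqueDiffOn h) (convex (D := D)))).smul
      (Torus.isSmoothSpaceTimeOn_const (Torus.isSmooth_const _) _)

/-- Smoothness / admissibility bookkeeping. [folklore] -/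
theorem smooth_ffun : Torus.IsSmoothSpaceTimeOn (Icc 0 D.T) D.ffun :=
  (((smooth_f₁ h).add (smooth_f₂ h)).add (smooth_f₃ h)).add (smooth_f₄ h)

omit h in
/-- Symmetry of `u ⊗ v + v ⊗ u` and of `v ⊗ v`. [folklore] -/
theorem tensorProd_symm_entries (u v : 𝕋³ → E³) (y : 𝕋³) (i j : Fin 3) :
    (Torus.tensorProd u v y i j + Torus.tensorProd v u y i j : ℝ) = Torus.tensorProd u v y j i + Torus.tensorProd v u y j i ∧
    (Torus.tensorProd v v y i j : ℝ) = Torus.tensorProd v v y j i := by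
  simp only [Torus.tensorProd, PiLp.smul_apply, smul_eq_mul]
  constructor <;> ring

/-- `S₁` is symmetric when `R_c` is. [folklore] -/
theorem S₁_symm {Rc : ℝ → 𝕋³ → Fin 3 → E³} (hRcsym : ∀ t ∈ Icc 0 D.T, ∀ y, ∀ i j : Fin 3, Rc t y i j = Rc t y j i)
    {t : ℝ} (ht : t ∈ Icc 0 D.T) (y : 𝕋³) (i j : Fin 3) : D.S₁ Rc t y i j = D.S₁ Rc t y j i := by
  have hc := tensorProd_symm_entries (D.wp t) (D.wr t) y i j
  have hosc : ∀ x, Torus.expansionTensor (D.cvec x t) (D.Psi x t) y i j = Torus.expansionTensor (D.cvec x t) (D.Psi x t) y j i :=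
    fun x => (Torus.expansionTensor_symm (isSmooth_Psi h x ht) y i j).symm
  simp only [S₁, cross, Sosc, PiLp.add_apply]
  rw [show (∑ x, Torus.expansionTensor (D.cvec x t) (D.Psi x t) y i) j = ∑ x, Torus.expansionTensor (D.cvec x t) (D.Psi x t) y i j from
      by simp [Finset.sum_apply],
    show (∑ x, Torus.expansionTensor (D.cvec x t) (D.Psi x t) y j) i = ∑ x, Torus.expansionTensor (D.cvec x t) (D.Psi x t) y j i from
      by simp [Finset.sum_apply],
    Finset.sum_congr rfl fun x _ => hosc x, hRcsym t ht y i j, hc.2]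
  linarith [hc.1]

/-- **The new Navier–Stokes–Reynolds triple.** If `(v, P, R_c + M̊)` solves the NSR system with
viscosity `ν` on `[0, T] × 𝕋³` (with `R_c` jointly smooth and symmetric), then so does
`(v + w, p_new, R_new)` with `R_new = S̊₁ + (v ⊗ w + w ⊗ v)˚ - ν(∇w' + ∇w'ᵀ)˚ + ℛ f`
(`Torus.IsNSReynoldsOn.perturb_visc` with the identity `(⋆)`). [cite: BuckmasterVicol2020, §7.6.1 (7.47)–(7.51)] -/
theorem isNSReynoldsOn_new {ν : ℝ} {v : ℝ → 𝕋³ → E³} {P : ℝ → 𝕋³ → ℝ} {Rc : ℝ → 𝕋³ → Fin 3 → E³}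
    (hold : Torus.IsNSReynoldsOn (Icc 0 D.T) ν v P (fun t y j => Rc t y j + Torus.traceless (D.M t) y j))
    (hRc : Torus.IsSmoothSpaceTimeOn (Icc 0 D.T) Rc) (hRcsym : ∀ t ∈ Icc 0 D.T, ∀ y, ∀ i j : Fin 3, Rc t y i j = Rc t y j i) :
    Torus.IsNSReynoldsOn (Icc 0 D.T) ν (fun t y => v t y + D.w t y) (Torus.perturbedPressureV ν v D.w' D.zeta P D.qfun (D.S₁ Rc))
      (Torus.perturbedStressV ν v D.w' D.zeta (D.S₁ Rc) D.ffun) := by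
  have e : (fun t y => v t y + D.w t y) = fun t y => v t y + Torus.incr D.w' D.zeta t y := rfl
  rw [e]
  exact Torus.IsNSReynoldsOn.perturb_visc hd3 h.hT hold (smooth_w' h) (smooth_zeta h) (fun t ht => isDivFree_w h ht)
    (fun t ht => hasZeroMean_w h ht) (smooth_S₁ h hRc) (fun t ht y i j => S₁_symm h hRcsym ht y i j) (smooth_qfun h) (smooth_ffun h)
    (fun t ht y => star h hRc ht y)

end Datum

end JetStep

end Literature.Analysis.FluidPDE
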